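import Summits.MatrixMultiplication.MatrixMultiplication.Theorems.AbelianSTPPCensusShapeCertVQDefsE

/-!
# Abelian STPP census — kernel evaluation of the budgeted vQ certificate checker `ShapeCertVQ.checkQE` (orders 395–397)

Cell mm-stpp, rung F-M1; successor kernel item VQ-CERT (T_E beyond 337 under vQ := vP ∧ E3⁺) in support of the closed crux item
stmt-MatrixMultiplication-19191; seat mm-stpp-vp-p2 (gen 1); support file (no definitions).  `ShapeCertVQ.checkQE M = true`
(`…ShapeCertVQDefsE`: the vQ search with the E3⁺ continuation budget) by `decide +kernel` (no `native_decide`, standard axioms), one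
theorem per order (≤ 1.2·10⁴ candidate visits each, seat sizing calc/segplanE_run*.txt), or — where one evaluation would exceed that — the
order's ROOT SEGMENTS `ShapeCertVQ.rootSegQE M i n`, assembled into `checkQE M = true` by `ShapeCertVQ.checkQE_of_root` in the leaf file;
`Elab.async false` keeps the kernel evaluations sequential.  Soundness: `ShapeCertVQ.checkQE_sound` (`…ShapeCertVQSearchE`), bridge
`ShapeCertVQ.shapeExclusionVQ_of_checkQE` (`…ShapeCertVQFinalE`).
WHAT THIS IS NOT: Boolean evaluations; no statement about STPP families or `ω` by themselves.
-/

set_option linter.dupNamespace false -- `MatrixMultiplication.MatrixMultiplication` (summit = problem, D-0017)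
set_option autoImplicit false
set_option Elab.async false -- sequential kernel evaluations (memory high-water of one order at a time)

namespace Summit.MatrixMultiplication.MatrixMultiplication.Theorems.ShapeCertVQ

set_option maxHeartbeats 0 in
/-- budgeted vQ certificate check at order `395` (≈ 9888 candidate visits; kernel evaluation) -/
theorem checkQE_395 : checkQE 395 = true := by
  decide +kernel

set_option maxHeartbeats 0 in
/-- budgeted vQ certificate check at order `396` (≈ 9912 candidate visits; kernel evaluation) -/
theorem checkQE_396 : checkQE 396 = true := by
  decide +kernel

set_option maxHeartbeats 0 in
/-- budgeted vQ certificate check at order `397` (≈ 9736 candidate visits; kernel evaluation) -/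
theorem checkQE_397 : checkQE 397 = true := by
  decide +kernel

end Summit.MatrixMultiplication.MatrixMultiplication.Theorems.ShapeCertVQ
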